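import Mathlib
import HarnessLib
import Summits.Ventures.LatticeQCDFlow.Exactness.SphereHMCExact

/-!
# Leapfrog on a finite family of spheres of mixed dimensions — the phase space of `cpn_2d.HMCCPN` (site spheres `S^{2N−1}`, link circles `S¹`): the proposal map, an involution preserving `(⊗ uniformSphere) ⊗ (⊗ Lebesgue)`

HONEST FRAMING: exact (Metropolis-corrected) sampling algorithms for lattice gauge theory;
figures of merit are autocorrelation/cost numbers at stated couplings and volumes; no
continuum-physics claim.

Venture `LatticeQCDFlow` (cell pub-lqcd), topic `Exactness`, FANOUT row 9 (eng-latcore, the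
engine `latflow.core.cpn_2d.HMCCPN`: `H = |π|²/2 + ω²/2 + S`, site momenta tangent to the site
spheres, link momenta on the circles, leapfrog with the exact free geodesic site update).  NEW WORK
of the cell over Mathlib and the tree: row 7's `SphereFrameLift.lean` / `SphereDriftLift.lean` /
`SphereHMCExact.lean` (ONE sphere `S^{d−1} ⊂ ℝ^d` with AMBIENT momenta: `ambientKick`,
`ambientFlip`, `ambientDrift` preserve `uniformSphere ⊗ Lebesgue`, time reversal of the drift),
row 7's `SphereLatticeHMCExact.lean` (a lattice of spheres of ONE dimension; its NOT-CLAIMED line: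
"the U(1) link variables of the CP(N−1) action as further factors (circles are the `d = 2` case of
the same construction; mixed dimensions are bookkeeping not done here)") and row 9's
`SplittingIntegrator.lean` (`IsFlipReversible`, `measurePreserving_perm_pow`).  Nothing is cited as
a fact.  Printed counterparts, NAMED ONLY: Duane–Kennedy–Pendleton–Roweth 1987; Engel–Schaefer,
Comput. Phys. Commun. 182 (2011) 2107, §2.2.

This file does the mixed-dimension bookkeeping, so that the engine's CP(N−1) HMC — sites AND links
in one leapfrog — becomes ONE kernel of the tree's `refreshUpdate (involMH …) …` form (part 1a of
the gen-16 chain; 1b `SphereFamilyLeapfrogHMC.lean` = the kernel and its exactness, 2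
`SphereExpMapMinorisation.lean`, 3 `SphereFamilyLeapfrogHMCErgodic.lean`, 4 `CPNLeapfrogHMCErgodic.lean`).

## Setting

A finite index type `ι` and a dimension family `k : ι → ℕ`: the variable `i` lives on the unit
sphere `FamS k i = S^{k i + 1}` of `FamE k i = ℝ^{k i + 2}` (CP(N−1): `k = 2N − 2` on sites, `0` on
links — exactly the `cpnDim` of `CPNHeatBathErgodic.lean`, so `CPNConfig V E d = Π i, FamS (cpnDim V E d) i`
definitionally).  Phase space `(Π i, FamS k i) × (Π i, FamE k i)`: AMBIENT momenta `p_i ∈ ℝ^{k i + 2}`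
(the engine draws `π = g − Re(z†g) z`, `g` a standard complex Gaussian — the tangential part of an
ambient standard Gaussian; the normal component is inert: row 7's `inner_ambientKick`,
`inner_ambientDrift`), reference measure `(⊗ uniformSphere) ⊗ (⊗ Lebesgue)`.

## Content

* §0 `piProdMEquiv` — the dependent `(Π i, α i × β i) ≃ᵐ (Π i, α i) × (Π i, β i)` and
  **`measurePreserving_piProdMEquiv`** (`⊗ᵢ (μᵢ ⊗ νᵢ) ↦ (⊗ᵢ μᵢ) ⊗ (⊗ᵢ νᵢ)`; Mathlib has the
  non-dependent `measurePreserving_arrowProdEquivProdArrow` only — same proof).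
* §1 `famSitewise` (apply a one-sphere phase-space map at every index; `measurePreserving_famSitewise`),
  `famKick` (coupled: index `i` feels `F x i`, a function of the WHOLE configuration), `famFlip`,
  `famDrift` (sitewise `ambientDrift`; `famDrift_fst_apply` / `famDrift_snd_apply`), the permutations
  `famKickPerm`, `famFlipPerm`, `famDriftPerm`, **`famLeapfrogPerm F δ`** (half kick – sitewise exact
  geodesic drift – half kick), **`famProposal F δ n`** (`n` steps then the flip),
  `involutive_famProposal` (an involution, any force / step / length),
  **`measurePreserving_famProposal`** (LIOUVILLE, any measurable force), `measurable_famProposal`.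

NOT CLAIMED here: the kernel and its exactness (part 1b), ergodicity (parts 2–4); floating point.
-/

noncomputable section

namespace Summit.Ventures.LatticeQCDFlow.Exactness

open MeasureTheory Measure Metric Set Real ProbabilityTheory
open scoped ENNReal InnerProductSpace

/-! ## §0 The dependent `(Π i, α i × β i) ≃ᵐ (Π i, α i) × (Π i, β i)` preserves product measures -/

section PiProd

variable {ι : Type*} {α β : ι → Type*} [∀ i, MeasurableSpace (α i)] [∀ i, MeasurableSpace (β i)]

/-- The dependent version of Mathlib's `MeasurableEquiv.arrowProdEquivProdArrow`:
`(Π i, α i × β i) ≃ᵐ (Π i, α i) × (Π i, β i)`, `w ↦ (i ↦ (w i).1, i ↦ (w i).2)`. -/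
def piProdMEquiv : (Π i, α i × β i) ≃ᵐ (Π i, α i) × (Π i, β i) where
  toEquiv := Equiv.arrowProdEquivProdArrow ι α β
  measurable_toFun :=
    (measurable_pi_lambda _ fun i => measurable_fst.comp (measurable_pi_apply i)).prodMk
      (measurable_pi_lambda _ fun i => measurable_snd.comp (measurable_pi_apply i))
  measurable_invFun :=
    measurable_pi_lambda _ fun i =>
      ((measurable_pi_apply i).comp measurable_fst).prodMk ((measurable_pi_apply i).comp measurable_snd)

/-- Pointwise form of `piProdMEquiv`. -/
theorem piProdMEquiv_apply (w : Π i, α i × β i) :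
    (piProdMEquiv w : (Π i, α i) × (Π i, β i)) = (fun i => (w i).1, fun i => (w i).2) := rfl

/-- Pointwise form of the inverse. -/
theorem piProdMEquiv_symm_apply (z : (Π i, α i) × (Π i, β i)) (i : ι) :
    (piProdMEquiv (α := α) (β := β)).symm z i = (z.1 i, z.2 i) := rfl

/-- **`piProdMEquiv` carries `⊗ᵢ (μᵢ ⊗ νᵢ)` to `(⊗ᵢ μᵢ) ⊗ (⊗ᵢ νᵢ)`** (σ-finite families, finite
index type; the proof of Mathlib's non-dependent `measurePreserving_arrowProdEquivProdArrow`,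
verbatim: both sides agree on boxes of rectangles, which generate and span). -/
theorem measurePreserving_piProdMEquiv [Fintype ι] (μ : ∀ i, Measure (α i)) (ν : ∀ i, Measure (β i))
    [∀ i, SigmaFinite (μ i)] [∀ i, SigmaFinite (ν i)] :
    MeasurePreserving (piProdMEquiv (α := α) (β := β))
      (Measure.pi fun i => (μ i).prod (ν i)) ((Measure.pi μ).prod (Measure.pi ν)) where
  measurable := (piProdMEquiv (α := α) (β := β)).measurable
  map_eq := by
    refine (FiniteSpanningSetsIn.ext ?_ (isPiSystem_pi.prod isPiSystem_pi)
      ((FiniteSpanningSetsIn.pi fun i => (μ i).toFiniteSpanningSetsIn).prod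
      (FiniteSpanningSetsIn.pi (fun i => (ν i).toFiniteSpanningSetsIn))) ?_).symm
    · refine (generateFrom_eq_prod generateFrom_pi generateFrom_pi ?_ ?_).symm
      · exact (FiniteSpanningSetsIn.pi (fun i => (μ i).toFiniteSpanningSetsIn)).isCountablySpanning
      · exact (FiniteSpanningSetsIn.pi (fun i => (ν i).toFiniteSpanningSetsIn)).isCountablySpanning
    · rintro _ ⟨s, ⟨s, _, rfl⟩, ⟨_, ⟨t, _, rfl⟩, rfl⟩⟩
      rw [MeasurableEquiv.map_apply]
      rw [show (piProdMEquiv (α := α) (β := β)) ⁻¹' (univ.pi s ×ˢ univ.pi t) =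
          (univ.pi fun i => s i ×ˢ t i) by
          ext w
          simp [piProdMEquiv_apply, Set.mem_pi, forall_and]]
      simp_rw [pi_pi, prod_prod, pi_pi, Finset.prod_mul_distrib]

end PiProd

/-! ## §1 The family phase space: sitewise drift and flip, coupled kicks -/

section Family

variable {ι : Type*} [Fintype ι] (k : ι → ℕ)

/-- The ambient space of index `i`: `ℝ^{k i + 2}`. -/
abbrev FamE (i : ι) : Type := EuclideanSpace ℝ (Fin (k i + 2))

/-- The variable at index `i`: a point of the unit sphere `S^{k i + 1} ⊂ ℝ^{k i + 2}`. -/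
abbrev FamS (i : ι) : Type := sphere (0 : FamE k i) 1

variable {k}

omit [Fintype ι] in
/-- Every ambient space has dimension at least two (`k i + 2`). -/
theorem two_le_card_fin_fam (i : ι) : 2 ≤ Fintype.card (Fin (k i + 2)) := by
  rw [Fintype.card_fin]; omega

/-- Apply a one-sphere phase-space map at every index of a family configuration. -/
def famSitewise (f : ∀ i, FamS k i × FamE k i → FamS k i × FamE k i)
    (z : (Π i, FamS k i) × (Π i, FamE k i)) : (Π i, FamS k i) × (Π i, FamE k i) :=
  (fun i => (f i (z.1 i, z.2 i)).1, fun i => (f i (z.1 i, z.2 i)).2)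

omit [Fintype ι] in
/-- `famSitewise f` is the dependent product map conjugated by `piProdMEquiv`. -/
theorem famSitewise_eq (f : ∀ i, FamS k i × FamE k i → FamS k i × FamE k i) :
    (famSitewise f : (Π i, FamS k i) × (Π i, FamE k i) → (Π i, FamS k i) × (Π i, FamE k i)) =
      (piProdMEquiv (α := FamS k) (β := FamE k)) ∘ (fun w i => f i (w i)) ∘
        (piProdMEquiv (α := FamS k) (β := FamE k)).symm := by
  rfl

omit [Fintype ι] in
/-- `famSitewise` is functorial. -/
theorem famSitewise_comp (f g : ∀ i, FamS k i × FamE k i → FamS k i × FamE k i) :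
    (famSitewise (fun i => f i ∘ g i) :
        (Π i, FamS k i) × (Π i, FamE k i) → (Π i, FamS k i) × (Π i, FamE k i)) =
      famSitewise f ∘ famSitewise g := by
  rfl

/-- **A sitewise map of measure-preserving one-sphere maps preserves `(⊗σᵢ) ⊗ (⊗ Lebesgue)`.** -/
theorem measurePreserving_famSitewise {f : ∀ i, FamS k i × FamE k i → FamS k i × FamE k i}
    {σ : ∀ i, Measure (FamS k i)} [∀ i, SigmaFinite (σ i)]
    (hf : ∀ i, MeasurePreserving (f i) ((σ i).prod (volume : Measure (FamE k i)))
      ((σ i).prod (volume : Measure (FamE k i)))) :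
    MeasurePreserving (famSitewise f : (Π i, FamS k i) × (Π i, FamE k i) → (Π i, FamS k i) × (Π i, FamE k i))
      ((Measure.pi σ).prod (Measure.pi fun i => (volume : Measure (FamE k i))))
      ((Measure.pi σ).prod (Measure.pi fun i => (volume : Measure (FamE k i)))) := by
  have hA := measurePreserving_piProdMEquiv (α := FamS k) (β := FamE k) σ
    (fun i => (volume : Measure (FamE k i)))
  have hpi : MeasurePreserving (fun (w : Π i, FamS k i × FamE k i) (i : ι) => f i (w i))
      (Measure.pi fun i => (σ i).prod (volume : Measure (FamE k i)))
      (Measure.pi fun i => (σ i).prod (volume : Measure (FamE k i))) :=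
    measurePreserving_pi _ _ hf
  rw [famSitewise_eq]
  exact hA.comp (hpi.comp hA.symm)

/-- The coupled KICK: index `i` feels `F x i`, a function of the whole configuration `x`:
`(x, p) ↦ (x, p + δ F x)`. -/
def famKick (F : (Π i, FamS k i) → (Π i, FamE k i)) (δ : ℝ) (z : (Π i, FamS k i) × (Π i, FamE k i)) :
    (Π i, FamS k i) × (Π i, FamE k i) :=
  (z.1, z.2 + δ • F z.1)

/-- **The kick preserves `μ ⊗ (⊗ Lebesgue)`** for every s-finite configuration law `μ` (a translation
of the momentum fibre over each configuration; Fubini). -/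
theorem measurePreserving_famKick {F : (Π i, FamS k i) → (Π i, FamE k i)} (hF : Measurable F) (δ : ℝ)
    (μ : Measure (Π i, FamS k i)) [SFinite μ] :
    MeasurePreserving (famKick F δ) (μ.prod (Measure.pi fun i => (volume : Measure (FamE k i))))
      (μ.prod (Measure.pi fun i => (volume : Measure (FamE k i)))) := by
  have hg : Measurable (Function.uncurry fun (x : Π i, FamS k i) (p : Π i, FamE k i) => p + δ • F x) :=
    measurable_snd.add ((hF.comp measurable_fst).const_smul δ)
  exact (MeasurePreserving.id μ).skew_product
    (g := fun (x : Π i, FamS k i) (p : Π i, FamE k i) => p + δ • F x) hg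
    (ae_of_all _ fun x =>
      (measurePreserving_add_right (Measure.pi fun i => (volume : Measure (FamE k i))) (δ • F x)).map_eq)

/-- The momentum flip `(x, p) ↦ (x, −p)`. -/
def famFlip (z : (Π i, FamS k i) × (Π i, FamE k i)) : (Π i, FamS k i) × (Π i, FamE k i) := (z.1, -z.2)

omit [Fintype ι] in
/-- The flip is `famSitewise ambientFlip`. -/
theorem famFlip_eq_sitewise :
    (famFlip : (Π i, FamS k i) × (Π i, FamE k i) → (Π i, FamS k i) × (Π i, FamE k i)) =
      famSitewise fun _ => ambientFlip := rfl

omit [Fintype ι] in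
/-- The flip is an involution. -/
@[simp] theorem famFlip_famFlip (z : (Π i, FamS k i) × (Π i, FamE k i)) : famFlip (famFlip z) = z := by
  simp [famFlip]

/-- The sitewise exact geodesic DRIFT (E–S eq. (11) at every index, ambient momenta, the normal
components carried). -/
def famDrift (t : ℝ) : (Π i, FamS k i) × (Π i, FamE k i) → (Π i, FamS k i) × (Π i, FamE k i) :=
  famSitewise fun _ => ambientDrift t

omit [Fintype ι] in
/-- The drifted position at index `i` is the one-sphere drift of `(x i, p i)`. -/
theorem famDrift_fst_apply (t : ℝ) (z : (Π i, FamS k i) × (Π i, FamE k i)) (i : ι) :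
    (famDrift t z).1 i = (ambientDrift t (z.1 i, z.2 i)).1 := rfl

omit [Fintype ι] in
/-- The drifted momentum at index `i` is the one-sphere drifted momentum of `(x i, p i)`. -/
theorem famDrift_snd_apply (t : ℝ) (z : (Π i, FamS k i) × (Π i, FamE k i)) (i : ι) :
    (famDrift t z).2 i = (ambientDrift t (z.1 i, z.2 i)).2 := rfl

omit [Fintype ι] in
/-- Time reversal of the family drift (sitewise `ambientDrift_flip_ambientDrift`). -/
theorem famDrift_flip_famDrift (t : ℝ) (z : (Π i, FamS k i) × (Π i, FamE k i)) :
    famDrift t (famFlip (famDrift t z)) = famFlip z := by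
  have h : ∀ i, ambientDrift t (ambientFlip (ambientDrift t (z.1 i, z.2 i))) = ambientFlip (z.1 i, z.2 i) :=
    fun i => ambientDrift_flip_ambientDrift t _
  refine Prod.ext (funext fun i => ?_) (funext fun i => ?_)
  · change (ambientDrift t (ambientFlip (ambientDrift t (z.1 i, z.2 i)))).1 = z.1 i
    rw [h i]; rfl
  · change (ambientDrift t (ambientFlip (ambientDrift t (z.1 i, z.2 i)))).2 = -z.2 i
    rw [h i]; rfl

/-- The kick as a permutation (inverse: the kick with `−δ`). -/
def famKickPerm (F : (Π i, FamS k i) → (Π i, FamE k i)) (δ : ℝ) :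
    Equiv.Perm ((Π i, FamS k i) × (Π i, FamE k i)) where
  toFun := famKick F δ
  invFun := famKick F (-δ)
  left_inv z := by simp [famKick]
  right_inv z := by simp [famKick]

/-- The flip as a permutation. -/
def famFlipPerm : Equiv.Perm ((Π i, FamS k i) × (Π i, FamE k i)) where
  toFun := famFlip
  invFun := famFlip
  left_inv := famFlip_famFlip
  right_inv := famFlip_famFlip

omit [Fintype ι] in
/-- The flip is an involution (as a permutation). -/
theorem famFlipPerm_mul_self :
    (famFlipPerm : Equiv.Perm ((Π i, FamS k i) × (Π i, FamE k i))) * famFlipPerm = 1 := by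
  ext z : 1
  exact famFlip_famFlip z

/-- The drift as a permutation (inverse: flip, drift, flip). -/
def famDriftPerm (t : ℝ) : Equiv.Perm ((Π i, FamS k i) × (Π i, FamE k i)) where
  toFun := famDrift t
  invFun z := famFlip (famDrift t (famFlip z))
  left_inv z := by
    change famFlip (famDrift t (famFlip (famDrift t z))) = z
    rw [famDrift_flip_famDrift, famFlip_famFlip]
  right_inv z := by
    change famDrift t (famFlip (famDrift t (famFlip z))) = z
    rw [famDrift_flip_famDrift, famFlip_famFlip]

omit [Fintype ι] in
/-- The kick is time-reversible (any force). -/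
theorem famKickPerm_isFlipReversible (F : (Π i, FamS k i) → (Π i, FamE k i)) (δ : ℝ) :
    IsFlipReversible (famFlipPerm : Equiv.Perm ((Π i, FamS k i) × (Π i, FamE k i))) (famKickPerm F δ) := by
  ext z : 1
  change famFlip (famKick F δ (famFlip z)) = famKick F (-δ) z
  refine Prod.ext rfl ?_
  simp only [famFlip, famKick, neg_add, neg_neg, neg_smul]

omit [Fintype ι] in
/-- The drift is time-reversible. -/
theorem famDriftPerm_isFlipReversible (t : ℝ) :
    IsFlipReversible (famFlipPerm : Equiv.Perm ((Π i, FamS k i) × (Π i, FamE k i))) (famDriftPerm t) := by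
  ext z : 1
  rfl

/-- **The family leapfrog step** (the engine's `HMCCPN.trajectory` step, sites and links together):
half kick by the coupled force, sitewise exact geodesic drift, half kick. -/
def famLeapfrogPerm (F : (Π i, FamS k i) → (Π i, FamE k i)) (δ : ℝ) :
    Equiv.Perm ((Π i, FamS k i) × (Π i, FamE k i)) :=
  famKickPerm F (δ / 2) * famDriftPerm δ * famKickPerm F (δ / 2)

/-- **The family proposal**: `n` leapfrog steps, then the flip. -/
def famProposal (F : (Π i, FamS k i) → (Π i, FamE k i)) (δ : ℝ) (n : ℕ) :
    Equiv.Perm ((Π i, FamS k i) × (Π i, FamE k i)) :=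
  famFlipPerm * famLeapfrogPerm F δ ^ n

omit [Fintype ι] in
/-- **The proposal is an involution** (every force, step, length). -/
theorem involutive_famProposal (F : (Π i, FamS k i) → (Π i, FamE k i)) (δ : ℝ) (n : ℕ) :
    Function.Involutive ⇑(famProposal F δ n) :=
  (((famKickPerm_isFlipReversible F (δ / 2)).palindrome (famDriftPerm_isFlipReversible δ)
    famFlipPerm_mul_self).pow famFlipPerm_mul_self n).involutive

/-- **Liouville for the family leapfrog**: the proposal preserves `(⊗ uniformSphere) ⊗ (⊗ Lebesgue)`
(any measurable force). -/
theorem measurePreserving_famProposal {F : (Π i, FamS k i) → (Π i, FamE k i)} (hF : Measurable F)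
    (δ : ℝ) (n : ℕ) :
    MeasurePreserving ⇑(famProposal F δ n)
      ((Measure.pi fun i => uniformSphere (volume : Measure (FamE k i))).prod
        (Measure.pi fun i => (volume : Measure (FamE k i))))
      ((Measure.pi fun i => uniformSphere (volume : Measure (FamE k i))).prod
        (Measure.pi fun i => (volume : Measure (FamE k i)))) := by
  have hK := measurePreserving_famKick hF (δ / 2)
    (Measure.pi fun i => uniformSphere (volume : Measure (FamE k i)))
  have hD : MeasurePreserving (famDrift (k := k) δ)
      ((Measure.pi fun i => uniformSphere (volume : Measure (FamE k i))).prod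
        (Measure.pi fun i => (volume : Measure (FamE k i))))
      ((Measure.pi fun i => uniformSphere (volume : Measure (FamE k i))).prod
        (Measure.pi fun i => (volume : Measure (FamE k i)))) :=
    measurePreserving_famSitewise fun i =>
      measurePreserving_ambientDrift (two_le_card_fin_fam i) δ (sphereDefault : FamS k i)
  have hR : MeasurePreserving (famFlip (k := k))
      ((Measure.pi fun i => uniformSphere (volume : Measure (FamE k i))).prod
        (Measure.pi fun i => (volume : Measure (FamE k i))))
      ((Measure.pi fun i => uniformSphere (volume : Measure (FamE k i))).prod
        (Measure.pi fun i => (volume : Measure (FamE k i)))) := by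
    rw [famFlip_eq_sitewise]
    exact measurePreserving_famSitewise fun i => measurePreserving_ambientFlip _
  have hL : MeasurePreserving ⇑(famLeapfrogPerm F δ)
      ((Measure.pi fun i => uniformSphere (volume : Measure (FamE k i))).prod
        (Measure.pi fun i => (volume : Measure (FamE k i))))
      ((Measure.pi fun i => uniformSphere (volume : Measure (FamE k i))).prod
        (Measure.pi fun i => (volume : Measure (FamE k i)))) := by
    rw [famLeapfrogPerm, Equiv.Perm.coe_mul, Equiv.Perm.coe_mul]
    exact (hK.comp hD).comp hK
  rw [famProposal, Equiv.Perm.coe_mul]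
  exact hR.comp (measurePreserving_perm_pow hL n)

/-- The proposal is measurable. -/
theorem measurable_famProposal {F : (Π i, FamS k i) → (Π i, FamE k i)} (hF : Measurable F)
    (δ : ℝ) (n : ℕ) : Measurable ⇑(famProposal F δ n) :=
  (measurePreserving_famProposal hF δ n).measurable

end Family

end Summit.Ventures.LatticeQCDFlow.Exactness

end
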